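import Mathlib
import Summits.KontsevichZagierPeriods.KontsevichZagierPeriods.Theorems.SoloInformedEulerBetaFamily
import HarnessLib
import HarnessLib.Audit

/-!
# SoloInformed — the point field `K ⊂ P` and algebraic descent (Theorem IX⁗, I)

**The point field.** The real algebraic numbers `K = integralClosure ℚ ℝ` map into the formal
period ring `P = KZ.FormalPeriodRing` by `α ↦ ⟦[pt, α]⟧` (the `0`-dimensional representation with
integrand `α`), and this is a RING HOMOMORPHISM `soloInformedPointHom : K →+* P`: sums by additivity
in the integrand (move 1b), products by Fubini on `ℝ⁰ × ℝ⁰` (`soloInformed_pointRep_mul`, landed in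
`SoloInformedEulerBetaFamily.lean`), one by the unit representation; and `evalP ∘ ⟦[pt,·]⟧ = id_K`
(`soloInformed_evalP_pointHom`). So `P` is canonically a `K`-algebra split by `evalP` on `K` — the
abstract-period analogue of "algebraic numbers are periods, with all their relations derivable".

**Algebraic descent** (`soloInformed_evalP_eq_zero_of_mem_algHull`). For any family
`c₁, …, c_k ∈ P` whose VALUES are algebraically independent over `ℚ`, `evalP` is injective on the
`K`-hull `K[c₁,…,c_k] ⊆ P` (`soloInformedAlgHull c`, the range of `K[X₁..X_k] → P`): independence
over `ℚ` extends to `K` (Mathlib `AlgebraicIndependent.integralClosure`) and a hull element is one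
`K`-polynomial at `c`, whose value is that polynomial at the values. Consequently the period
conjecture holds for every pair of representations with classes in the hull
(`soloInformed_kzp_on_algHull`) — algebraic multipliers (`√3`, `∛4`, `4^a`, …) cost NOTHING once a
transcendence input for the generators is available. This supersedes the case-by-case quadratic
descent of `SoloInformedIsogenySector.lean` and is the engine of the decided hulls of §6octies.
Residency `solo-KontsevichZagierPeriods-informed` (s22); paper §6octies (rung S2).

References: M. Kontsevich, D. Zagier, *Periods* (2001), §1.2; A. Huber, S. Müller-Stach,
*Periods and Nori motives* (2017), §13.1.
-/

noncomputable section

open MeasureTheory Set Filter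
namespace Summit.KontsevichZagierPeriods.KontsevichZagierPeriods.Theorems

open Literature.NumberTheory.Transcendental Literature.NumberTheory.Transcendental.KZ
open Literature.ModelTheory.ExponentialFields

/-! ### The real algebraic numbers inside `P`: point classes form a subring -/

/-- A real number in the integral closure of `ℚ` in `ℝ` is algebraic over `ℚ`. [folklore] -/
theorem soloInformed_isAlgebraic_of_mem_integralClosure {x : ℝ}
    (hx : x ∈ integralClosure ℚ ℝ) : IsAlgebraic ℚ x :=
  ((mem_integralClosure_iff ℚ ℝ).1 hx).isAlgebraic

/-- **Additivity of point representations** (rule 1b on the point):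
`⟦[pt, x]⟧ + ⟦[pt, y]⟧ = ⟦[pt, x + y]⟧`. [Kontsevich–Zagier 2001, §1.2 rule (1)] -/
theorem soloInformed_pointRep_add (x y : ℝ) (hx : IsAlgebraic ℚ x) (hy : IsAlgebraic ℚ y)
    (hxy : IsAlgebraic ℚ (x + y)) :
    toFormalPeriod (of (IntegralRep.unit.constMul x hx)) +
      toFormalPeriod (of (IntegralRep.unit.constMul y hy)) =
      toFormalPeriod (of (IntegralRep.unit.constMul (x + y) hxy)) := by
  have hmem : of (IntegralRep.unit.constMul (x + y) hxy) - of (IntegralRep.unit.constMul x hx) -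
      of (IntegralRep.unit.constMul y hy) ∈ integrandAddRel :=
    ⟨0, IntegralRep.unit.constMul (x + y) hxy, IntegralRep.unit.constMul x hx,
      IntegralRep.unit.constMul y hy, rfl, rfl, fun z _ => by
        simp only [IntegralRep.integrand_constMul, IntegralRep.unit_integrand, Pi.add_apply]
        ring, rfl⟩
  have h := integrandAddRel_subset_relations hmem
  rw [sub_sub] at h
  rw [← map_add]
  exact (toFormalPeriod_eq_iff.mpr h).symm

/-- `⟦[pt, 1]⟧ = 1` in `P` (the integrand `1 · 1` agrees with that of the unit representation).
[Kontsevich–Zagier 2001, §1.2] -/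
theorem soloInformed_pointRep_one (h1 : IsAlgebraic ℚ (1 : ℝ)) :
    toFormalPeriod (of (IntegralRep.unit.constMul 1 h1)) = 1 := by
  have h : Equivalent (IntegralRep.unit.constMul 1 h1) IntegralRep.unit :=
    of_sub_of_mem_relations_of_eqOn rfl fun z _ => by
      simp only [IntegralRep.integrand_constMul, IntegralRep.unit_integrand, one_mul]
  rw [h.toFormalPeriod_eq]
  rfl

/-- **The point-class map** `K → P`, `x ↦ ⟦[pt, x]⟧`, on the ring `K = integralClosure ℚ ℝ` of
real algebraic numbers: a RING HOMOMORPHISM (products: Fubini on `ℝ⁰ × ℝ⁰`; sums: additivity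
in the integrand; one: the unit representation). [Kontsevich–Zagier 2001, §1.2] -/
def soloInformedPointHom : integralClosure ℚ ℝ →+* FormalPeriodRing where
  toFun x := toFormalPeriod (of (IntegralRep.unit.constMul (x : ℝ)
    (soloInformed_isAlgebraic_of_mem_integralClosure x.2)))
  map_one' := soloInformed_pointRep_one _
  map_mul' x y := (soloInformed_pointRep_mul _ _ _ _ _).symm
  map_zero' := by
    have h := soloInformed_pointRep_add 0 0 (soloInformed_isAlgebraic_of_mem_integralClosure
      (0 : integralClosure ℚ ℝ).2) (soloInformed_isAlgebraic_of_mem_integralClosure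
      (0 : integralClosure ℚ ℝ).2) (by simpa using isAlgebraic_nat 0)
    have h' : toFormalPeriod (of (IntegralRep.unit.constMul ((0:ℝ) + 0)
        (by simpa using isAlgebraic_nat 0))) = toFormalPeriod (of (IntegralRep.unit.constMul (0:ℝ)
        (soloInformed_isAlgebraic_of_mem_integralClosure (0 : integralClosure ℚ ℝ).2))) := by
      congr 2
      simp
    rw [h'] at h
    simpa using h
  map_add' x y := (soloInformed_pointRep_add _ _ _ _ _).symm

/-- The point class of `x ∈ K`, for any proof of algebraicity. [folklore] -/
theorem soloInformed_pointHom_apply (x : ℝ) (hx : x ∈ integralClosure ℚ ℝ)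
    (hx' : IsAlgebraic ℚ x) :
    soloInformedPointHom ⟨x, hx⟩ = toFormalPeriod (of (IntegralRep.unit.constMul x hx')) := rfl

/-- `evalP ⟦[pt, x]⟧ = x`: the point-class map splits `evalP`. [Kontsevich–Zagier 2001, §1.2] -/
@[simp] theorem soloInformed_evalP_pointHom (x : integralClosure ℚ ℝ) :
    evalP (soloInformedPointHom x) = x := by
  show evalP (toFormalPeriod (of _)) = _
  rw [evalP_toFormalPeriod_of, IntegralRep.value_constMul, IntegralRep.value_unit, mul_one]

/-- `evalP ∘ ⟦[pt, ·]⟧ = (K ↪ ℝ)` as ring homomorphisms. [folklore] -/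
theorem soloInformed_evalP_comp_pointHom :
    evalP.comp soloInformedPointHom = algebraMap (integralClosure ℚ ℝ) ℝ := by
  ext x
  simp

/-! ### Algebraic descent: the `K`-hull of an algebraically independent family is decided -/

/-- **The `K`-hull** of a family `c : Fin k → P`: the subring `K[c₁,…,c_k] ⊆ P` generated by
ALL algebraic point classes `⟦[pt, α]⟧` (`α ∈ K`) and the `cᵢ` — realised as the range of the
evaluation map `K[X₁,…,X_k] → P`. [this work] -/
def soloInformedAlgHull {k : ℕ} (c : Fin k → FormalPeriodRing) : Subring FormalPeriodRing :=
  (MvPolynomial.eval₂Hom soloInformedPointHom c).range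

/-- Point classes lie in the hull. [folklore] -/
theorem soloInformed_pointHom_mem_algHull {k : ℕ} (c : Fin k → FormalPeriodRing)
    (a : integralClosure ℚ ℝ) : soloInformedPointHom a ∈ soloInformedAlgHull c :=
  ⟨MvPolynomial.C a, by simp⟩

/-- The generators lie in the hull. [folklore] -/
theorem soloInformed_mem_algHull_self {k : ℕ} (c : Fin k → FormalPeriodRing) (i : Fin k) :
    c i ∈ soloInformedAlgHull c :=
  ⟨MvPolynomial.X i, by simp⟩

/-- The `ℤ`-subalgebra generated by the point classes and the `cᵢ` is contained in (indeed equal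
to) the hull. [folklore] -/
theorem soloInformed_adjoin_le_algHull {k : ℕ} (c : Fin k → FormalPeriodRing) :
    Algebra.adjoin ℤ (Set.range soloInformedPointHom ∪ Set.range c) ≤
      subalgebraOfSubring (soloInformedAlgHull c) := by
  refine Algebra.adjoin_le ?_
  rintro x (⟨a, rfl⟩ | ⟨i, rfl⟩)
  · exact soloInformed_pointHom_mem_algHull c a
  · exact soloInformed_mem_algHull_self c i

/-- `evalP` of an evaluated `K`-polynomial is the polynomial evaluated at the values (over `K`).
[folklore] -/
theorem soloInformed_evalP_eval₂_pointHom {k : ℕ} (c : Fin k → FormalPeriodRing)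
    (p : MvPolynomial (Fin k) (integralClosure ℚ ℝ)) :
    evalP (MvPolynomial.eval₂ soloInformedPointHom c p) =
      MvPolynomial.aeval (fun i => evalP (c i)) p := by
  rw [MvPolynomial.eval₂_comp_left, soloInformed_evalP_comp_pointHom, MvPolynomial.aeval_def]
  rfl

/-- **Algebraic descent.** If the values `evalP c₁, …, evalP c_k` are algebraically independent
over `ℚ`, then `evalP` is INJECTIVE on the `K`-hull `K[c₁,…,c_k]`: the independence extends to
`K` (Mathlib `AlgebraicIndependent.integralClosure`), and an element of the hull is ONE polynomial
over `K` evaluated at `c`, whose value is that polynomial at the values. [this work] -/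
theorem soloInformed_evalP_eq_zero_of_mem_algHull {k : ℕ} (c : Fin k → FormalPeriodRing)
    (hind : AlgebraicIndependent ℚ fun i => evalP (c i)) {x : FormalPeriodRing}
    (hx : x ∈ soloInformedAlgHull c) (h0 : evalP x = 0) : x = 0 := by
  obtain ⟨p, rfl⟩ := hx
  have hK : AlgebraicIndependent (integralClosure ℚ ℝ) fun i => evalP (c i) :=
    hind.integralClosure
  have hp : MvPolynomial.aeval (fun i => evalP (c i)) p = 0 := by
    rw [← soloInformed_evalP_eval₂_pointHom]; exact h0
  have hp0 : p = 0 := hK.eq_zero_of_aeval_eq_zero _ hp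
  simp [hp0]

/-- **`KZP` on the `K`-hull of an independent family.** If `evalP c₁, …, evalP c_k` are
algebraically independent over `ℚ`, the conclusion of the period conjecture holds for every pair
of representations (any dimensions) whose classes lie in `K[c₁,…,c_k]`: equal values ⇒
equivalent by the moves. [this work] -/
theorem soloInformed_kzp_on_algHull {k : ℕ} (c : Fin k → FormalPeriodRing)
    (hind : AlgebraicIndependent ℚ fun i => evalP (c i)) {n m : ℕ} (r : IntegralRep n)
    (r' : IntegralRep m) (hr : toFormalPeriod (of r) ∈ soloInformedAlgHull c)
    (hr' : toFormalPeriod (of r') ∈ soloInformedAlgHull c) (hv : r.value = r'.value) :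
    Equivalent r r' := by
  have hx := sub_mem hr hr'
  have h0 : evalP (toFormalPeriod (of r) - toFormalPeriod (of r')) = 0 := by
    rw [map_sub, evalP_toFormalPeriod_of, evalP_toFormalPeriod_of, hv, sub_self]
  have h := soloInformed_evalP_eq_zero_of_mem_algHull c hind hx h0
  exact toFormalPeriod_eq_iff.mp (sub_eq_zero.mp h)

/-- **Every relation among the values is derivable on the hull**: a `K`-polynomial vanishing at
the values of an independent family… is zero; more usefully, two hull elements with the same
value are EQUAL in `P`. [this work] -/
theorem soloInformed_eq_of_evalP_eq_of_mem_algHull {k : ℕ} (c : Fin k → FormalPeriodRing)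
    (hind : AlgebraicIndependent ℚ fun i => evalP (c i)) {x y : FormalPeriodRing}
    (hx : x ∈ soloInformedAlgHull c) (hy : y ∈ soloInformedAlgHull c) (h : evalP x = evalP y) :
    x = y :=
  sub_eq_zero.mp (soloInformed_evalP_eq_zero_of_mem_algHull c hind (sub_mem hx hy)
    (by rw [map_sub, h, sub_self]))

end Summit.KontsevichZagierPeriods.KontsevichZagierPeriods.Theorems

end
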